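import Literature.MathematicalPhysics.QuantumManyBody.DiluteBoseGasTrialAmplitudes
import Literature.MathematicalPhysics.QuantumManyBody.LatticePowerSums
import Literature.MathematicalPhysics.QuantumManyBody.CubicTrialVectorScalars
import HarnessLib

/-!
# The BCS trial state: lattice sums (`‖σ‖²`, `‖η_H‖²`, `K₁`, `sup σ²`, `|P_S|`)

Topic `Literature/MathematicalPhysics/QuantumManyBody`, namespace `BoseGas.BCSTrial`; theorem-only, for
the provefact `Literature.MathematicalPhysics.QuantumManyBody.BoseGas.BastiCenatiempoSchlein2021_upperBound`.
The norm bounds of §2 and §5 of [BastiCenatiempoSchlein2021] for the concrete trial state, with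
explicit constants in `W(0) = ∫v` and explicit powers of `ρ` (`L = ρ^{-11/10}`, `N = ρL³`):

* transfer of sums over the momentum box to `ℤ³` and the generic weighted sums
  `∑_{0<|n|²≤A} |n|⁻¹ ≤ 96A`, `∑_{|n|²>A} |n|⁻⁴ ≤ 192√3/√A`, `#{|n|² ≤ A} ≤ 24(√A+1)³`;
* `S = ∑σ² ≤ C_S ρ^{-9/5}` (`‖σ_L‖² ≤ CN^{3κ/2}`), `‖η_H‖² ≤ C_H ρ^{-7/5}` (`≤ CN^{3κ-1+ε}`),
  `K₁ = ∑|κ|² ≤ C_K ρ^{-9/10}`, `sup_{P_S∪P_H} σ² ≤ C_∞ ρ^{-1/20}`, `|P_S| ≤ C ρ^{-21/10}`.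

## References

* [BastiCenatiempoSchlein2021] G. Basti, S. Cenatiempo, B. Schlein, Forum Math. Sigma 9 (2021) e74,
  arXiv:2101.06222: §2 (bounds after (2.8) and (2.11)), §5.
-/

noncomputable section

namespace Literature.MathematicalPhysics.QuantumManyBody.BoseGas

open MeasureTheory Complex Finset
open scoped ENNReal BigOperators

namespace BCSTrial

variable {v : ℝ → ℝ≥0∞} {ρ : ℝ}

/-! ### Transfer to `ℤ³` and the sup norm -/

/-- `∑_{p ∈ s} G(e p) = ∑_{n ∈ e(s)} G(n)`. [folklore] -/
theorem sum_eq_sum_map {M : ℕ} (s : Finset (ModeBox M)) (G : Momentum → ℝ) :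
    ∑ p ∈ s, G (e M p) = ∑ n ∈ s.map ⟨e M, e_injective M⟩, G n := (Finset.sum_map s ⟨e M, e_injective M⟩ G).symm

/-- `|n|∞² ≤ |n|²` in the notation `nsq`. [folklore] -/
theorem supNorm_sq_le_nsq' (n : Momentum) : (((univ.sup fun j => (n j).natAbs : ℕ)) : ℝ) ^ 2 ≤ nsq n :=
  supNorm_sq_le_nsq n

/-- `|n|² ≤ 3|n|∞²` in the notation `nsq`. [folklore] -/
theorem nsq_le_three_supNorm_sq' (n : Momentum) : nsq n ≤ 3 * (((univ.sup fun j => (n j).natAbs : ℕ)) : ℝ) ^ 2 :=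
  nsq_le_three_supNorm_sq n

/-- `|n|² ≤ A ⟹ |n|∞ ≤ ⌊√A⌋₊`. [folklore] -/
theorem supNorm_le_floor_sqrt {n : Momentum} {A : ℝ} (h : nsq n ≤ A) :
    (univ.sup fun j => (n j).natAbs) ≤ ⌊Real.sqrt A⌋₊ := by
  have h1 := supNorm_sq_le_nsq' n
  have h2 : (((univ.sup fun j => (n j).natAbs : ℕ)) : ℝ) ≤ Real.sqrt A :=
    Real.le_sqrt_of_sq_le (h1.trans h)
  exact Nat.le_floor h2

/-- `|n|² > A ≥ 0 ⟹ |n|∞ ≥ ⌊√(A/3)⌋₊ + 1`. [folklore] -/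
theorem floor_sqrt_lt_supNorm {n : Momentum} {A : ℝ} (hA : 0 ≤ A) (h : A < nsq n) :
    ⌊Real.sqrt (A / 3)⌋₊ + 1 ≤ (univ.sup fun j => (n j).natAbs) := by
  have h1 := nsq_le_three_supNorm_sq' n
  have h2 : Real.sqrt (A / 3) < (((univ.sup fun j => (n j).natAbs : ℕ)) : ℝ) := by
    rw [Real.sqrt_lt' (by
      by_contra h0; push Not at h0
      have : (((univ.sup fun j => (n j).natAbs : ℕ)) : ℝ) = 0 := le_antisymm h0 (Nat.cast_nonneg _)
      rw [this] at h1; linarith)]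
    nlinarith
  exact Nat.succ_le_of_lt (Nat.floor_lt (by positivity) |>.2 h2)

/-- `0 < |n|² ⟹ 1 ≤ |n|∞`. [folklore] -/
theorem one_le_supNorm {n : Momentum} (h : 0 < nsq n) : 1 ≤ (univ.sup fun j => (n j).natAbs) := by
  by_contra h0
  push Not at h0
  have : (univ.sup fun j => (n j).natAbs) = 0 := by omega
  have h1 := nsq_le_three_supNorm_sq' n
  rw [this] at h1; simp at h1; linarith

/-! ### Generic weighted sums over the box -/

/-- **`∑_{p : 0 < |n|² ≤ A} |n|⁻¹ ≤ 96A`** (`|n| = √nsq`). [folklore] -/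
theorem sum_inv_sqrt_nsq_le {M : ℕ} (s : Finset (ModeBox M)) {A : ℝ} (hA : 0 ≤ A)
    (hs : ∀ p ∈ s, 0 < nsq (e M p) ∧ nsq (e M p) ≤ A) :
    ∑ p ∈ s, (Real.sqrt (nsq (e M p)))⁻¹ ≤ 96 * A := by
  set R := ⌊Real.sqrt A⌋₊ with hR
  calc ∑ p ∈ s, (Real.sqrt (nsq (e M p)))⁻¹
      ≤ ∑ p ∈ s, ((((univ.sup fun j => (e M p j).natAbs : ℕ)) : ℝ))⁻¹ := by
        refine Finset.sum_le_sum fun p hp => ?_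
        have h1 := one_le_supNorm (hs p hp).1
        have h1' : (1 : ℝ) ≤ (((univ.sup fun j => (e M p j).natAbs : ℕ)) : ℝ) := by exact_mod_cast h1
        refine inv_anti₀ (by linarith) ?_
        exact Real.le_sqrt_of_sq_le (supNorm_sq_le_nsq' _)
    _ = ∑ n ∈ s.map ⟨e M, e_injective M⟩, ((((univ.sup fun j => (n j).natAbs : ℕ)) : ℝ))⁻¹ :=
        sum_eq_sum_map s (fun n => ((((univ.sup fun j => (n j).natAbs : ℕ)) : ℝ))⁻¹)
    _ = ∑ n ∈ (s.map ⟨e M, e_injective M⟩).filter (fun n => 1 ≤ (univ.sup fun j => (n j).natAbs) ∧ (univ.sup fun j => (n j).natAbs) ≤ R),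
          ((((univ.sup fun j => (n j).natAbs : ℕ)) : ℝ))⁻¹ := by
        rw [Finset.filter_true_of_mem]
        intro n hn
        rw [Finset.mem_map] at hn
        obtain ⟨p, hp, rfl⟩ := hn
        exact ⟨one_le_supNorm (hs p hp).1, supNorm_le_floor_sqrt (hs p hp).2⟩
    _ ≤ 96 * (R : ℝ) ^ 2 := sum_inv_supNorm_le _ R
    _ ≤ 96 * A := by
        gcongr
        have h1 : (R : ℝ) ≤ Real.sqrt A := Nat.floor_le (Real.sqrt_nonneg _)
        calc (R : ℝ) ^ 2 ≤ Real.sqrt A ^ 2 := pow_le_pow_left₀ (Nat.cast_nonneg _) h1 2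
          _ = A := Real.sq_sqrt hA

/-- **`∑_{p : |n|² > A} |n|⁻⁴ ≤ 192√3/√A`** (`A > 0`). [folklore] -/
theorem sum_inv_nsq_sq_le {M : ℕ} (s : Finset (ModeBox M)) {A : ℝ} (hA : 0 < A)
    (hs : ∀ p ∈ s, A < nsq (e M p)) :
    ∑ p ∈ s, (nsq (e M p) ^ 2)⁻¹ ≤ 192 * Real.sqrt 3 / Real.sqrt A := by
  set N := ⌊Real.sqrt (A / 3)⌋₊ + 1 with hN
  have hN1 : 1 ≤ N := Nat.le_add_left 1 _
  calc ∑ p ∈ s, (nsq (e M p) ^ 2)⁻¹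
      ≤ ∑ p ∈ s, ((((univ.sup fun j => (e M p j).natAbs : ℕ)) : ℝ) ^ 4)⁻¹ := by
        refine Finset.sum_le_sum fun p hp => ?_
        have h0 : 0 < nsq (e M p) := hA.trans (hs p hp)
        have h1 := one_le_supNorm h0
        have h1' : (1 : ℝ) ≤ (((univ.sup fun j => (e M p j).natAbs : ℕ)) : ℝ) := by exact_mod_cast h1
        refine inv_anti₀ (by positivity) ?_
        calc ((((univ.sup fun j => (e M p j).natAbs : ℕ)) : ℝ) ^ 4) = ((((univ.sup fun j => (e M p j).natAbs : ℕ)) : ℝ) ^ 2) ^ 2 := by ring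
          _ ≤ nsq (e M p) ^ 2 := pow_le_pow_left₀ (sq_nonneg _) (supNorm_sq_le_nsq' _) 2
    _ = ∑ n ∈ s.map ⟨e M, e_injective M⟩, ((((univ.sup fun j => (n j).natAbs : ℕ)) : ℝ) ^ 4)⁻¹ :=
        sum_eq_sum_map s (fun n => ((((univ.sup fun j => (n j).natAbs : ℕ)) : ℝ) ^ 4)⁻¹)
    _ = ∑ n ∈ (s.map ⟨e M, e_injective M⟩).filter (fun n => N ≤ (univ.sup fun j => (n j).natAbs)),
          ((((univ.sup fun j => (n j).natAbs : ℕ)) : ℝ) ^ 4)⁻¹ := by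
        rw [Finset.filter_true_of_mem]
        intro n hn
        rw [Finset.mem_map] at hn
        obtain ⟨p, hp, rfl⟩ := hn
        exact floor_sqrt_lt_supNorm hA.le (hs p hp)
    _ ≤ 192 / (N : ℝ) := sum_inv_supNorm_pow_four_le _ hN1
    _ ≤ 192 * Real.sqrt 3 / Real.sqrt A := by
        have hsA : 0 < Real.sqrt A := Real.sqrt_pos.2 hA
        have hs3 : 0 < Real.sqrt (A / 3) := Real.sqrt_pos.2 (by positivity)
        have hNgt : Real.sqrt (A / 3) < N := by rw [hN]; push_cast; exact Nat.lt_floor_add_one _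
        rw [div_le_div_iff₀ (by positivity) hsA]
        have h3 : Real.sqrt A = Real.sqrt 3 * Real.sqrt (A / 3) := by
          rw [← Real.sqrt_mul (by norm_num)]; congr 1; ring
        rw [h3]
        nlinarith [Real.sqrt_nonneg 3, Real.sq_sqrt (show (0 : ℝ) ≤ 3 by norm_num)]

/-- **`#{p : |n|² ≤ A} ≤ 24(√A + 1)³`.** [folklore] -/
theorem card_nsq_le {M : ℕ} (s : Finset (ModeBox M)) {A : ℝ} (hs : ∀ p ∈ s, nsq (e M p) ≤ A) :
    (s.card : ℝ) ≤ 24 * (Real.sqrt A + 1) ^ 3 := by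
  set R := ⌊Real.sqrt A⌋₊ with hR
  have h1 : s.card = (s.map ⟨e M, e_injective M⟩).card := (Finset.card_map _).symm
  have h2 : ((s.map ⟨e M, e_injective M⟩).filter (fun n => (univ.sup fun j => (n j).natAbs) ≤ R)) = s.map ⟨e M, e_injective M⟩ := by
    rw [Finset.filter_true_of_mem]
    intro n hn
    rw [Finset.mem_map] at hn
    obtain ⟨p, hp, rfl⟩ := hn
    exact supNorm_le_floor_sqrt (hs p hp)
  have h3 := card_supNorm_le (s.map ⟨e M, e_injective M⟩) R
  rw [h2] at h3
  rw [h1]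
  refine h3.trans ?_
  have hR' : (R : ℝ) ≤ Real.sqrt A := Nat.floor_le (Real.sqrt_nonneg _)
  gcongr

/-! ### Powers of `ρ` -/

/-- `L² = ρ^{-11/5}`. [folklore] -/
theorem boxSide_sq (hρ : 0 < ρ) : boxSide ρ ^ 2 = ρ ^ (-(11 : ℝ) / 5) := by
  unfold boxSide
  rw [← Real.rpow_natCast, ← Real.rpow_mul hρ.le]; norm_num

/-- `L⁴ = ρ^{-22/5}`. [folklore] -/
theorem boxSide_pow_four (hρ : 0 < ρ) : boxSide ρ ^ 4 = ρ ^ (-(22 : ℝ) / 5) := by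
  unfold boxSide
  rw [← Real.rpow_natCast, ← Real.rpow_mul hρ.le]; norm_num

/-- `√ρ·L·ρ^{-6/5} = ρ^{-9/5}`. [folklore] -/
theorem rpow_combo₁ (hρ : 0 < ρ) : Real.sqrt ρ * boxSide ρ * ρ ^ (-(6 : ℝ) / 5) = ρ ^ (-(9 : ℝ) / 5) := by
  unfold boxSide
  rw [Real.sqrt_eq_rpow, ← Real.rpow_add hρ, ← Real.rpow_add hρ]; norm_num

/-- `ρ²L⁴ρ^{3/5} = ρ^{-9/5}`. [folklore] -/
theorem rpow_combo₂ (hρ : 0 < ρ) : ρ ^ 2 * boxSide ρ ^ 4 * ρ ^ ((3 : ℝ) / 5) = ρ ^ (-(9 : ℝ) / 5) := by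
  rw [boxSide_pow_four hρ, show (ρ ^ 2 : ℝ) = ρ ^ (2 : ℝ) by rw [← Real.rpow_natCast]; norm_num,
    ← Real.rpow_add hρ, ← Real.rpow_add hρ]; norm_num

/-- `ρ²L⁴ρ^{7/10} = ρ^{-17/10}`. [folklore] -/
theorem rpow_combo₃ (hρ : 0 < ρ) : ρ ^ 2 * boxSide ρ ^ 4 * ρ ^ ((7 : ℝ) / 10) = ρ ^ (-(17 : ℝ) / 10) := by
  rw [boxSide_pow_four hρ, show (ρ ^ 2 : ℝ) = ρ ^ (2 : ℝ) by rw [← Real.rpow_natCast]; norm_num,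
    ← Real.rpow_add hρ, ← Real.rpow_add hρ]; norm_num

/-- `ρ²L⁴ρ = ρ^{-7/5}`. [folklore] -/
theorem rpow_combo₄ (hρ : 0 < ρ) : ρ ^ 2 * boxSide ρ ^ 4 * ρ = ρ ^ (-(7 : ℝ) / 5) := by
  rw [boxSide_pow_four hρ, show (ρ ^ 2 : ℝ) * ρ ^ (-(22 : ℝ) / 5) * ρ = ρ ^ (3 : ℝ) * ρ ^ (-(22 : ℝ) / 5) by
    rw [show (ρ ^ (3 : ℝ) : ℝ) = ρ ^ 2 * ρ by rw [← Real.rpow_natCast]; norm_num; ring]; ring,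
    ← Real.rpow_add hρ]; norm_num

/-- `√ρ·L·ρ^{11/20} = ρ^{-1/20}`. [folklore] -/
theorem rpow_combo₅ (hρ : 0 < ρ) : Real.sqrt ρ * boxSide ρ * ρ ^ ((11 : ℝ) / 20) = ρ ^ (-(1 : ℝ) / 20) := by
  unfold boxSide
  rw [Real.sqrt_eq_rpow, ← Real.rpow_add hρ, ← Real.rpow_add hρ]; norm_num

/-- `√(ρ^{-a}) = ρ^{-a/2}` instances: `√(ρ^{-6/5}) = ρ^{-3/5}` etc., as `1/√(ρ^{-a}) = ρ^{a/2}`. [folklore] -/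
theorem inv_sqrt_rpow_neg (hρ : 0 < ρ) (a : ℝ) : (Real.sqrt (ρ ^ (-a)))⁻¹ = ρ ^ (a / 2) := by
  rw [Real.sqrt_eq_rpow, ← Real.rpow_mul hρ.le, ← Real.rpow_neg hρ.le]
  congr 1; ring

/-! ### Pointwise majorants in terms of `|n|²` -/

section Majorants

variable (hv : Measurable v) (hint : (∫⁻ x : Space, v ‖x‖) ≠ ⊤) (hρ : 0 < ρ)
include hv hint hρ

/-- On `P_L`: **`σ_p² ≤ √(ρW(0))·L/(4√2π) · |n|⁻¹`.** [cite: BastiCenatiempoSchlein2021, §2 ("`‖σ_L‖²_∞ ≤ CN^{κ/2}/|p|`")] -/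
theorem sigma_sq_le_inv_sqrt {p : ModeBox (boxSize ρ)} (hp : p ∈ lowSet ρ) :
    Fock.bogSigma (neg _) (halfSpace _) (tAmp v ρ) p ^ 2 ≤
      Real.sqrt (ρ * W v ρ 0) * boxSide ρ / (4 * Real.sqrt 2 * Real.pi) * (Real.sqrt (nsq (e _ p)))⁻¹ := by
  obtain ⟨h1, h2, -⟩ := bogSigma_sq_le_of_mem hv hint hρ hp
  have hε := eps_pos' hρ (ne_z_of_mem_lowSet hp)
  have hg := gCoupling_nonneg hv hint hρ
  have hgle := gCoupling_le hv hint hρ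
  have hL := boxSide_pos hρ
  have hn : 0 < nsq (e _ p) := (mem_lowSet.1 hp).1
  set X := gCoupling v ρ / (2 * Real.sqrt (eps ρ p ^ 2 + 2 * gCoupling v ρ * eps ρ p)) with hX
  have hX0 : 0 ≤ X := div_nonneg hg (by positivity)
  -- `X ≤ √(g/(8ε)) ≤ √(ρW0 L²/(32π² nsq))`
  have h3 : X ≤ Real.sqrt (gCoupling v ρ / (8 * eps ρ p)) := Real.le_sqrt_of_sq_le h2
  have h4 : gCoupling v ρ / (8 * eps ρ p) ≤ ρ * W v ρ 0 * boxSide ρ ^ 2 / (32 * Real.pi ^ 2 * nsq (e _ p)) := by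
    rw [eps_eq, div_le_div_iff₀ (by positivity) (by positivity)]
    have := mul_le_mul_of_nonneg_right hgle (show 0 ≤ boxSide ρ ^ 2 * (32 * Real.pi ^ 2 * nsq (e _ p)) by positivity)
    calc gCoupling v ρ * (32 * Real.pi ^ 2 * nsq (e (boxSize ρ) p))
        = gCoupling v ρ * (8 * (4 * Real.pi ^ 2 * nsq (e (boxSize ρ) p) / boxSide ρ ^ 2)) * boxSide ρ ^ 2 := by
          field_simp; ring
      _ ≤ ρ * W v ρ 0 * boxSide ρ ^ 2 * (8 * (4 * Real.pi ^ 2 * nsq (e (boxSize ρ) p) / boxSide ρ ^ 2)) := by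
          nlinarith [mul_le_mul_of_nonneg_right hgle (show 0 ≤ (8 * (4 * Real.pi ^ 2 * nsq (e (boxSize ρ) p) / boxSide ρ ^ 2)) * boxSide ρ ^ 2 by positivity)]
  have h5 : Real.sqrt (ρ * W v ρ 0 * boxSide ρ ^ 2 / (32 * Real.pi ^ 2 * nsq (e _ p))) =
      Real.sqrt (ρ * W v ρ 0) * boxSide ρ / (4 * Real.sqrt 2 * Real.pi) * (Real.sqrt (nsq (e _ p)))⁻¹ := by
    rw [Real.sqrt_div' _ (by positivity), Real.sqrt_mul' _ (sq_nonneg _), Real.sqrt_sq hL.le,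
      Real.sqrt_mul' _ hn.le, show (32 : ℝ) * Real.pi ^ 2 = (4 * Real.sqrt 2 * Real.pi) ^ 2 by
        rw [mul_pow, mul_pow, Real.sq_sqrt (by norm_num : (0:ℝ) ≤ 2)]; ring, Real.sqrt_sq (by positivity)]
    field_simp
  calc _ ≤ X := h1
    _ ≤ Real.sqrt (gCoupling v ρ / (8 * eps ρ p)) := h3
    _ ≤ Real.sqrt (ρ * W v ρ 0 * boxSide ρ ^ 2 / (32 * Real.pi ^ 2 * nsq (e _ p))) := Real.sqrt_le_sqrt h4
    _ = _ := h5

/-- On `P_L`: **`σ_p² ≤ ρ²W(0)²L⁴/(32π⁴) · |n|⁻⁴`.** [cite: BastiCenatiempoSchlein2021, §2 ("`|σ_L(p)| ≤ N^κ/|p|²`")] -/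
theorem sigma_sq_le_inv_nsq_sq {p : ModeBox (boxSize ρ)} (hp : p ∈ lowSet ρ) :
    Fock.bogSigma (neg _) (halfSpace _) (tAmp v ρ) p ^ 2 ≤
      ρ ^ 2 * W v ρ 0 ^ 2 * boxSide ρ ^ 4 / (32 * Real.pi ^ 4) * (nsq (e _ p) ^ 2)⁻¹ := by
  have h1 := bogSigma_sq_le_of_mem' hv hint hρ hp
  have hε := eps_pos' hρ (ne_z_of_mem_lowSet hp)
  have hg := gCoupling_nonneg hv hint hρ
  have hgle := gCoupling_le hv hint hρ
  have hL := boxSide_pos hρ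
  have hn : 0 < nsq (e _ p) := (mem_lowSet.1 hp).1
  refine h1.trans ?_
  have hg2 : gCoupling v ρ ^ 2 ≤ (ρ * W v ρ 0) ^ 2 := pow_le_pow_left₀ hg hgle 2
  rw [eps_eq]
  calc gCoupling v ρ ^ 2 / (2 * (4 * Real.pi ^ 2 * nsq (e (boxSize ρ) p) / boxSide ρ ^ 2) ^ 2)
      ≤ (ρ * W v ρ 0) ^ 2 / (2 * (4 * Real.pi ^ 2 * nsq (e (boxSize ρ) p) / boxSide ρ ^ 2) ^ 2) :=
        div_le_div_of_nonneg_right hg2 (by positivity)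
    _ = _ := by field_simp; ring

/-- Off the condensate: **`η_p² ≤ ρ²W(0)²L⁴/(64π⁴) · |n|⁻⁴`.** [cite: BastiCenatiempoSchlein2021, (2.4)] -/
theorem eta_sq_le_inv_nsq_sq {p : ModeBox (boxSize ρ)} (hp : p ≠ z _) :
    eta v ρ p ^ 2 ≤ ρ ^ 2 * W v ρ 0 ^ 2 * boxSide ρ ^ 4 / (64 * Real.pi ^ 4) * (nsq (e _ p) ^ 2)⁻¹ := by
  have h := abs_eta_le hv hint hρ hp
  have hn : 0 < nsq (e _ p) := by
    have := one_le_nsq (n := e _ p) (fun h0 => hp ((e_eq_zero_iff _ p).1 h0)); linarith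
  have hL := boxSide_pos hρ
  have h0 : 0 ≤ ρ * W v ρ 0 * boxSide ρ ^ 2 / (8 * Real.pi ^ 2 * nsq (e _ p)) := by
    have := W_zero_nonneg v ρ; positivity
  calc eta v ρ p ^ 2 = |eta v ρ p| ^ 2 := (sq_abs _).symm
    _ ≤ (ρ * W v ρ 0 * boxSide ρ ^ 2 / (8 * Real.pi ^ 2 * nsq (e _ p))) ^ 2 := pow_le_pow_left₀ (abs_nonneg _) h 2
    _ = _ := by field_simp; ring

end Majorants

/-! ### `‖σ‖²` -/

section SigmaNorm

variable (hv : Measurable v) (hint : (∫⁻ x : Space, v ‖x‖) ≠ ⊤) (hρ : 0 < ρ)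
include hv hint hρ

/-- **`∑_{P_L} σ² ≤ (24/(√2π))√W(0)·ρ^{-9/5} + (6√3/π⁴)W(0)²·ρ^{-9/5}`** (`‖σ_L‖² ≤ CN^{3κ/2}`;
split at `|n|² = ρ^{-6/5}`, i.e. `|p| = N^{κ/2}`). [cite: BastiCenatiempoSchlein2021, §2 ("`‖σ_L‖² ≤ CN^{3κ/2}`")] -/
theorem sum_lowSet_sigma_sq_le :
    ∑ p ∈ lowSet ρ, Fock.bogSigma (neg _) (halfSpace _) (tAmp v ρ) p ^ 2 ≤
      (24 / (Real.sqrt 2 * Real.pi) * Real.sqrt (W v ρ 0) + 6 * Real.sqrt 3 / Real.pi ^ 4 * W v ρ 0 ^ 2) *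
        ρ ^ (-(9 : ℝ) / 5) := by
  have hL := boxSide_pos hρ
  have hW0 := W_zero_nonneg v ρ
  set A : ℝ := ρ ^ (-(6 : ℝ) / 5) with hA
  have hA0 : 0 < A := Real.rpow_pos_of_pos hρ _
  rw [← Finset.sum_filter_add_sum_filter_not (lowSet ρ) (fun p => nsq (e _ p) ≤ A)]
  -- part 1: `|n|² ≤ A`
  have h1 : ∑ p ∈ (lowSet ρ).filter (fun p => nsq (e _ p) ≤ A), Fock.bogSigma (neg _) (halfSpace _) (tAmp v ρ) p ^ 2 ≤
      Real.sqrt (ρ * W v ρ 0) * boxSide ρ / (4 * Real.sqrt 2 * Real.pi) * (96 * A) := by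
    calc _ ≤ ∑ p ∈ (lowSet ρ).filter (fun p => nsq (e _ p) ≤ A),
          Real.sqrt (ρ * W v ρ 0) * boxSide ρ / (4 * Real.sqrt 2 * Real.pi) * (Real.sqrt (nsq (e _ p)))⁻¹ :=
          Finset.sum_le_sum fun p hp => sigma_sq_le_inv_sqrt hv hint hρ (Finset.mem_filter.1 hp).1
      _ = Real.sqrt (ρ * W v ρ 0) * boxSide ρ / (4 * Real.sqrt 2 * Real.pi) *
          ∑ p ∈ (lowSet ρ).filter (fun p => nsq (e _ p) ≤ A), (Real.sqrt (nsq (e _ p)))⁻¹ := by rw [Finset.mul_sum]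
      _ ≤ _ := by
          refine mul_le_mul_of_nonneg_left (sum_inv_sqrt_nsq_le _ hA0.le fun p hp => ?_) (by positivity)
          rw [Finset.mem_filter] at hp
          exact ⟨(mem_lowSet.1 hp.1).1, hp.2⟩
  -- part 2: `|n|² > A`
  have h2 : ∑ p ∈ (lowSet ρ).filter (fun p => ¬ nsq (e _ p) ≤ A), Fock.bogSigma (neg _) (halfSpace _) (tAmp v ρ) p ^ 2 ≤
      ρ ^ 2 * W v ρ 0 ^ 2 * boxSide ρ ^ 4 / (32 * Real.pi ^ 4) * (192 * Real.sqrt 3 / Real.sqrt A) := by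
    calc _ ≤ ∑ p ∈ (lowSet ρ).filter (fun p => ¬ nsq (e _ p) ≤ A),
          ρ ^ 2 * W v ρ 0 ^ 2 * boxSide ρ ^ 4 / (32 * Real.pi ^ 4) * (nsq (e _ p) ^ 2)⁻¹ :=
          Finset.sum_le_sum fun p hp => sigma_sq_le_inv_nsq_sq hv hint hρ (Finset.mem_filter.1 hp).1
      _ = ρ ^ 2 * W v ρ 0 ^ 2 * boxSide ρ ^ 4 / (32 * Real.pi ^ 4) *
          ∑ p ∈ (lowSet ρ).filter (fun p => ¬ nsq (e _ p) ≤ A), (nsq (e _ p) ^ 2)⁻¹ := by rw [Finset.mul_sum]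
      _ ≤ _ := by
          refine mul_le_mul_of_nonneg_left (sum_inv_nsq_sq_le _ hA0 fun p hp => ?_) (by positivity)
          rw [Finset.mem_filter] at hp
          exact lt_of_not_ge hp.2
  -- the powers of `ρ`
  have e1 : Real.sqrt (ρ * W v ρ 0) * boxSide ρ / (4 * Real.sqrt 2 * Real.pi) * (96 * A) =
      24 / (Real.sqrt 2 * Real.pi) * Real.sqrt (W v ρ 0) * ρ ^ (-(9 : ℝ) / 5) := by
    rw [Real.sqrt_mul' _ hW0, ← rpow_combo₁ hρ, hA]
    field_simp
    ring
  have e2 : ρ ^ 2 * W v ρ 0 ^ 2 * boxSide ρ ^ 4 / (32 * Real.pi ^ 4) * (192 * Real.sqrt 3 / Real.sqrt A) =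
      6 * Real.sqrt 3 / Real.pi ^ 4 * W v ρ 0 ^ 2 * ρ ^ (-(9 : ℝ) / 5) := by
    rw [div_eq_mul_inv (192 * Real.sqrt 3), hA, show (-(6 : ℝ) / 5) = -((6 : ℝ) / 5) by ring, inv_sqrt_rpow_neg hρ,
      show ((6 : ℝ) / 5 / 2) = (3 : ℝ) / 5 by norm_num, ← rpow_combo₂ hρ]
    field_simp
    ring
  rw [e1] at h1
  rw [e2] at h2
  calc _ ≤ _ := add_le_add h1 h2
    _ = _ := by ring

/-- **`∑_{p ∉ P_L} σ² ≤ (4√3/π⁴)W(0)²·ρ^{-17/10}`** (`σ² ≤ (4/3)η²` off `P_L`).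
[cite: BastiCenatiempoSchlein2021, §2 ("`|σ_H(p)| ≤ C|η_p|`")] -/
theorem sum_not_lowSet_sigma_sq_le :
    ∑ p ∈ Finset.univ.filter (fun p => p ∉ lowSet ρ), Fock.bogSigma (neg _) (halfSpace _) (tAmp v ρ) p ^ 2 ≤
      4 * Real.sqrt 3 / Real.pi ^ 4 * W v ρ 0 ^ 2 * ρ ^ (-(17 : ℝ) / 10) := by
  have hL := boxSide_pos hρ
  have hW0 := W_zero_nonneg v ρ
  set B : ℝ := ρ ^ (-(7 : ℝ) / 5) with hB
  have hB0 : 0 < B := Real.rpow_pos_of_pos hρ _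
  -- drop the condensate (its term vanishes)
  have hsplit : ∑ p ∈ Finset.univ.filter (fun p => p ∉ lowSet ρ), Fock.bogSigma (neg _) (halfSpace _) (tAmp v ρ) p ^ 2 =
      ∑ p ∈ Finset.univ.filter (fun p => p ∉ lowSet ρ ∧ p ≠ z _), Fock.bogSigma (neg _) (halfSpace _) (tAmp v ρ) p ^ 2 := by
    symm
    refine Finset.sum_subset (fun p hp => ?_) (fun p hp hp' => ?_)
    · rw [Finset.mem_filter] at hp ⊢; exact ⟨hp.1, hp.2.1⟩
    · rw [Finset.mem_filter] at hp hp'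
      have hpz : p = z _ := by
        by_contra h; exact hp' ⟨hp.1, hp.2, h⟩
      rw [hpz, Fock.bogSigma_z (fun q hq => neg_not_mem_halfSpace hq) (neg_z _)]
      ring
  rw [hsplit]
  calc _ ≤ ∑ p ∈ Finset.univ.filter (fun p => p ∉ lowSet ρ ∧ p ≠ z _),
        ρ ^ 2 * W v ρ 0 ^ 2 * boxSide ρ ^ 4 / (48 * Real.pi ^ 4) * (nsq (e _ p) ^ 2)⁻¹ := by
        refine Finset.sum_le_sum fun p hp => ?_
        rw [Finset.mem_filter] at hp
        have h1 := (angles_le_of_not_mem hv hint hρ hp.2.1).1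
        have h2 := eta_sq_le_inv_nsq_sq hv hint hρ hp.2.2
        calc _ ≤ 4 / 3 * eta v ρ p ^ 2 := h1
          _ ≤ 4 / 3 * (ρ ^ 2 * W v ρ 0 ^ 2 * boxSide ρ ^ 4 / (64 * Real.pi ^ 4) * (nsq (e _ p) ^ 2)⁻¹) := by gcongr
          _ = _ := by ring
    _ = ρ ^ 2 * W v ρ 0 ^ 2 * boxSide ρ ^ 4 / (48 * Real.pi ^ 4) *
        ∑ p ∈ Finset.univ.filter (fun p => p ∉ lowSet ρ ∧ p ≠ z _), (nsq (e _ p) ^ 2)⁻¹ := by rw [Finset.mul_sum]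
    _ ≤ ρ ^ 2 * W v ρ 0 ^ 2 * boxSide ρ ^ 4 / (48 * Real.pi ^ 4) * (192 * Real.sqrt 3 / Real.sqrt B) := by
        refine mul_le_mul_of_nonneg_left (sum_inv_nsq_sq_le _ hB0 fun p hp => ?_) (by positivity)
        rw [Finset.mem_filter] at hp
        have hn1 : 1 ≤ nsq (e _ p) := one_le_nsq (fun h0 => hp.2.2 ((e_eq_zero_iff _ p).1 h0))
        by_contra hle
        exact hp.2.1 (mem_lowSet.2 ⟨by linarith, le_of_not_gt hle⟩)
    _ = _ := by
        rw [div_eq_mul_inv (192 * Real.sqrt 3), hB, show (-(7 : ℝ) / 5) = -((7 : ℝ) / 5) by ring, inv_sqrt_rpow_neg hρ,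
          show ((7 : ℝ) / 5 / 2) = (7 : ℝ) / 10 by norm_num, ← rpow_combo₃ hρ]
        field_simp
        ring

/-- **`S = ∑σ² ≤ C_S ρ^{-9/5}`** for `ρ ≤ 1`, with
`C_S = (24/(√2π))√W(0) + (10√3/π⁴)W(0)²`. [cite: BastiCenatiempoSchlein2021, §2, (eq:fixN0)] -/
theorem depletion_le (hρ1 : ρ ≤ 1) :
    depletion v ρ ≤ (24 / (Real.sqrt 2 * Real.pi) * Real.sqrt (W v ρ 0) + 10 * Real.sqrt 3 / Real.pi ^ 4 * W v ρ 0 ^ 2) *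
      ρ ^ (-(9 : ℝ) / 5) := by
  have hW0 := W_zero_nonneg v ρ
  unfold depletion
  rw [← Finset.sum_filter_add_sum_filter_not Finset.univ (fun p => p ∈ lowSet ρ), Finset.filter_mem_eq_inter,
    Finset.univ_inter]
  have h1 := sum_lowSet_sigma_sq_le hv hint hρ
  have h2 := sum_not_lowSet_sigma_sq_le hv hint hρ
  have h3 : ρ ^ (-(17 : ℝ) / 10) ≤ ρ ^ (-(9 : ℝ) / 5) :=
    Real.rpow_le_rpow_of_exponent_ge hρ hρ1 (by norm_num)
  have h4 : 4 * Real.sqrt 3 / Real.pi ^ 4 * W v ρ 0 ^ 2 * ρ ^ (-(17 : ℝ) / 10) ≤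
      4 * Real.sqrt 3 / Real.pi ^ 4 * W v ρ 0 ^ 2 * ρ ^ (-(9 : ℝ) / 5) :=
    mul_le_mul_of_nonneg_left h3 (by positivity)
  calc _ ≤ _ := add_le_add h1 h2
    _ ≤ (24 / (Real.sqrt 2 * Real.pi) * Real.sqrt (W v ρ 0) + 6 * Real.sqrt 3 / Real.pi ^ 4 * W v ρ 0 ^ 2) *
        ρ ^ (-(9 : ℝ) / 5) + 4 * Real.sqrt 3 / Real.pi ^ 4 * W v ρ 0 ^ 2 * ρ ^ (-(9 : ℝ) / 5) := add_le_add le_rfl h4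
    _ = _ := by ring

/-- `∑_{P_S} σ² ≤ ∑_{P_L} σ²`-type: **`∑_{P_S} σ² ≤ C ρ^{-9/5}`** (`P_S ⊆ P_L`). [cite: BastiCenatiempoSchlein2021, §2 ("`‖σ_S‖² ≤ CN^{3κ/2}`")] -/
theorem sum_softSet_sigma_sq_le :
    ∑ p ∈ softSet ρ, Fock.bogSigma (neg _) (halfSpace _) (tAmp v ρ) p ^ 2 ≤
      (24 / (Real.sqrt 2 * Real.pi) * Real.sqrt (W v ρ 0) + 6 * Real.sqrt 3 / Real.pi ^ 4 * W v ρ 0 ^ 2) *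
        ρ ^ (-(9 : ℝ) / 5) :=
  (Finset.sum_le_sum_of_subset_of_nonneg (softSet_subset_lowSet hρ) fun _ _ _ => sq_nonneg _).trans
    (sum_lowSet_sigma_sq_le hv hint hρ)

end SigmaNorm

/-! ### `‖η_H‖²`, `K₁`, `sup σ²`, `|P_S|` -/

section EtaNorm

variable (hv : Measurable v) (hint : (∫⁻ x : Space, v ‖x‖) ≠ ⊤) (hρ : 0 < ρ)
include hv hint hρ

/-- **`‖η_H‖² = ∑_{P_H} η² ≤ (3√3/π⁴)W(0)²·ρ^{-7/5}`** (`‖η_H‖² ≤ CN^{3κ-1+ε}`).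
[cite: BastiCenatiempoSchlein2021, §2 ("`‖η_H‖² ≤ CN^{3κ-1+ε}`")] -/
theorem sum_hardSet_eta_sq_le :
    ∑ p ∈ hardSet ρ, eta v ρ p ^ 2 ≤ 3 * Real.sqrt 3 / Real.pi ^ 4 * W v ρ 0 ^ 2 * ρ ^ (-(7 : ℝ) / 5) := by
  have hL := boxSide_pos hρ
  have hW0 := W_zero_nonneg v ρ
  set D : ℝ := ρ ^ (-(2 : ℝ)) with hD
  have hD0 : 0 < D := Real.rpow_pos_of_pos hρ _
  calc _ ≤ ∑ p ∈ hardSet ρ, ρ ^ 2 * W v ρ 0 ^ 2 * boxSide ρ ^ 4 / (64 * Real.pi ^ 4) * (nsq (e _ p) ^ 2)⁻¹ :=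
        Finset.sum_le_sum fun p hp => eta_sq_le_inv_nsq_sq hv hint hρ (fun h => z_not_mem_hardSet hρ (h ▸ hp))
    _ = ρ ^ 2 * W v ρ 0 ^ 2 * boxSide ρ ^ 4 / (64 * Real.pi ^ 4) * ∑ p ∈ hardSet ρ, (nsq (e _ p) ^ 2)⁻¹ := by
        rw [Finset.mul_sum]
    _ ≤ ρ ^ 2 * W v ρ 0 ^ 2 * boxSide ρ ^ 4 / (64 * Real.pi ^ 4) * (192 * Real.sqrt 3 / Real.sqrt D) :=
        mul_le_mul_of_nonneg_left (sum_inv_nsq_sq_le _ hD0 fun p hp => mem_hardSet.1 hp) (by positivity)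
    _ = _ := by
        rw [div_eq_mul_inv (192 * Real.sqrt 3), hD, inv_sqrt_rpow_neg hρ, show ((2 : ℝ) / 2) = (1 : ℝ) by norm_num,
          Real.rpow_one, ← rpow_combo₄ hρ]
        field_simp
        ring

omit hv hint in
/-- **`K₁ = ∑_τ|κ_τ|² ≤ (4/N)·(∑_{P_H}η²)·(∑_{P_S}σ²)`** (`(η_u+η_a)² ≤ 2η_u² + 2η_a²`; the maps
`τ ↦ (u,b)` and `τ ↦ (a,b)` are injective). [cite: BastiCenatiempoSchlein2021, (4.2) ("`N^{-1}∑(η_r+η_{r+v})²σ_v² ≤ CN^δ`")] -/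
theorem ampNormSq_kappa_le :
    Fock.ampNormSq (kappa v ρ) ≤ 4 / particleNumber ρ *
      ((∑ p ∈ hardSet ρ, eta v ρ p ^ 2) * ∑ p ∈ softSet ρ, Fock.bogSigma (neg _) (halfSpace _) (tAmp v ρ) p ^ 2) := by
  classical
  have hN := particleNumber_pos hρ
  set sg := Fock.bogSigma (neg (boxSize ρ)) (halfSpace _) (tAmp v ρ) with hsg
  set η := eta v ρ with hη
  -- pointwise
  have hpt : ∀ τ : Fock.Triple (e (boxSize ρ)) (hardSet ρ) (softSet ρ), ‖kappa v ρ τ‖ ^ 2 ≤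
      2 / particleNumber ρ * (η τ.u ^ 2 * sg τ.b ^ 2) + 2 / particleNumber ρ * (η τ.a ^ 2 * sg τ.b ^ 2) := by
    intro τ
    unfold kappa
    rw [Complex.norm_real, Real.norm_eq_abs, sq_abs, div_pow, Real.sq_sqrt hN.le]
    rw [div_le_iff₀ hN]
    have : (2 / particleNumber ρ * (η τ.u ^ 2 * sg τ.b ^ 2) + 2 / particleNumber ρ * (η τ.a ^ 2 * sg τ.b ^ 2)) * particleNumber ρ =
        2 * (η τ.u ^ 2 + η τ.a ^ 2) * sg τ.b ^ 2 := by field_simp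
    rw [this]
    nlinarith [sq_nonneg (η τ.u - η τ.a), sq_nonneg (sg τ.b)]
  -- the two injections
  have hinjU : Function.Injective fun τ : Fock.Triple (e (boxSize ρ)) (hardSet ρ) (softSet ρ) => (τ.u, τ.b) := by
    intro τ τ' h
    simp only [Prod.mk.injEq] at h
    have ha : τ.a = τ'.a := by
      apply e_injective
      have h1 := τ.prop.2.2.2.1; have h2 := τ'.prop.2.2.2.1
      rw [h.1, h.2] at h1
      exact add_left_cancel (add_right_cancel (h1.trans h2.symm))
    exact Fock.Triple.ext' h.1 ha h.2
  have hinjA : Function.Injective fun τ : Fock.Triple (e (boxSize ρ)) (hardSet ρ) (softSet ρ) => (τ.a, τ.b) := by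
    intro τ τ' h
    simp only [Prod.mk.injEq] at h
    have hu : τ.u = τ'.u := by
      apply e_injective
      have h1 := τ.prop.2.2.2.1; have h2 := τ'.prop.2.2.2.1
      rw [h.1, h.2] at h1
      have h3 := h1.trans h2.symm
      rw [add_assoc, add_assoc] at h3
      exact add_right_cancel h3
    exact Fock.Triple.ext' hu h.1 h.2
  -- the bound for one injection
  have hsum : ∀ (g : Fock.Triple (e (boxSize ρ)) (hardSet ρ) (softSet ρ) → ModeBox (boxSize ρ) × ModeBox (boxSize ρ)),
      Function.Injective g → (∀ τ, (g τ).1 ∈ hardSet ρ ∧ (g τ).2 ∈ softSet ρ) →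
      ∑ τ, η (g τ).1 ^ 2 * sg (g τ).2 ^ 2 ≤ (∑ p ∈ hardSet ρ, η p ^ 2) * ∑ p ∈ softSet ρ, sg p ^ 2 := by
    intro g hg hmem
    rw [Finset.sum_mul_sum, ← Finset.sum_product (hardSet ρ) (softSet ρ) (fun x : ModeBox (boxSize ρ) × ModeBox (boxSize ρ) => η x.1 ^ 2 * sg x.2 ^ 2),
      ← Finset.sum_image (f := fun x : ModeBox (boxSize ρ) × ModeBox (boxSize ρ) => η x.1 ^ 2 * sg x.2 ^ 2) (hg.injOn)]
    refine Finset.sum_le_sum_of_subset_of_nonneg (fun x hx => ?_) (fun x _ _ => by positivity)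
    rw [Finset.mem_image] at hx
    obtain ⟨τ, -, rfl⟩ := hx
    exact Finset.mem_product.2 (hmem τ)
  have hU := hsum _ hinjU (fun τ => ⟨τ.prop.1, τ.prop.2.2.1⟩)
  have hA := hsum _ hinjA (fun τ => ⟨τ.prop.2.1, τ.prop.2.2.1⟩)
  simp only at hU hA
  unfold Fock.ampNormSq
  calc _ ≤ ∑ τ : Fock.Triple (e (boxSize ρ)) (hardSet ρ) (softSet ρ),
        (2 / particleNumber ρ * (η τ.u ^ 2 * sg τ.b ^ 2) + 2 / particleNumber ρ * (η τ.a ^ 2 * sg τ.b ^ 2)) :=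
        Finset.sum_le_sum fun τ _ => hpt τ
    _ = 2 / particleNumber ρ * ∑ τ : Fock.Triple (e (boxSize ρ)) (hardSet ρ) (softSet ρ), η τ.u ^ 2 * sg τ.b ^ 2 +
        2 / particleNumber ρ * ∑ τ : Fock.Triple (e (boxSize ρ)) (hardSet ρ) (softSet ρ), η τ.a ^ 2 * sg τ.b ^ 2 := by
        rw [Finset.sum_add_distrib, Finset.mul_sum, Finset.mul_sum]
    _ ≤ 2 / particleNumber ρ * ((∑ p ∈ hardSet ρ, η p ^ 2) * ∑ p ∈ softSet ρ, sg p ^ 2) +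
        2 / particleNumber ρ * ((∑ p ∈ hardSet ρ, η p ^ 2) * ∑ p ∈ softSet ρ, sg p ^ 2) := by
        gcongr
    _ = _ := by ring

/-- **`K₁ ≤ C_K ρ^{-9/10}`** with `C_K = (12√3/π⁴)W(0)²·((24/(√2π))√W(0) + (6√3/π⁴)W(0)²)`
(`N = ρ^{-23/10}`). [cite: BastiCenatiempoSchlein2021, (4.2)] -/
theorem ampNormSq_kappa_le' :
    Fock.ampNormSq (kappa v ρ) ≤ 12 * Real.sqrt 3 / Real.pi ^ 4 * W v ρ 0 ^ 2 *
      (24 / (Real.sqrt 2 * Real.pi) * Real.sqrt (W v ρ 0) + 6 * Real.sqrt 3 / Real.pi ^ 4 * W v ρ 0 ^ 2) *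
        ρ ^ (-(9 : ℝ) / 10) := by
  have hN := particleNumber_pos hρ
  have hW0 := W_zero_nonneg v ρ
  have h1 := sum_hardSet_eta_sq_le hv hint hρ
  have h2 := sum_softSet_sigma_sq_le hv hint hρ
  have h0 : 0 ≤ ∑ p ∈ hardSet ρ, eta v ρ p ^ 2 := Finset.sum_nonneg fun _ _ => sq_nonneg _
  have hNeq : particleNumber ρ = ρ ^ (-(23 : ℝ) / 10) := by
    unfold particleNumber boxSide
    rw [← Real.rpow_natCast, ← Real.rpow_mul hρ.le, show (ρ : ℝ) * ρ ^ (-(11 : ℝ) / 10 * ((3 : ℕ) : ℝ)) =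
      ρ ^ (1 : ℝ) * ρ ^ (-(11 : ℝ) / 10 * ((3 : ℕ) : ℝ)) by rw [Real.rpow_one], ← Real.rpow_add hρ]
    norm_num
  have hpow : 4 / particleNumber ρ * (ρ ^ (-(7 : ℝ) / 5) * ρ ^ (-(9 : ℝ) / 5)) = 4 * ρ ^ (-(9 : ℝ) / 10) := by
    rw [hNeq, ← Real.rpow_add hρ, div_mul_eq_mul_div, div_eq_iff (Real.rpow_pos_of_pos hρ _).ne', mul_assoc,
      ← Real.rpow_add hρ]
    norm_num
  calc _ ≤ _ := ampNormSq_kappa_le hρ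
    _ ≤ 4 / particleNumber ρ * ((3 * Real.sqrt 3 / Real.pi ^ 4 * W v ρ 0 ^ 2 * ρ ^ (-(7 : ℝ) / 5)) *
        ((24 / (Real.sqrt 2 * Real.pi) * Real.sqrt (W v ρ 0) + 6 * Real.sqrt 3 / Real.pi ^ 4 * W v ρ 0 ^ 2) *
          ρ ^ (-(9 : ℝ) / 5))) := by
        refine mul_le_mul_of_nonneg_left (mul_le_mul h1 h2 (Finset.sum_nonneg fun _ _ => sq_nonneg _) (by positivity))
          (by positivity)
    _ = 3 * Real.sqrt 3 / Real.pi ^ 4 * W v ρ 0 ^ 2 *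
        (24 / (Real.sqrt 2 * Real.pi) * Real.sqrt (W v ρ 0) + 6 * Real.sqrt 3 / Real.pi ^ 4 * W v ρ 0 ^ 2) *
        (4 / particleNumber ρ * (ρ ^ (-(7 : ℝ) / 5) * ρ ^ (-(9 : ℝ) / 5))) := by ring
    _ = _ := by rw [hpow]; ring

/-- **`sup_{P_S} σ² ≤ (√W(0)/(4√2π)) ρ^{-1/20}`** (`‖σ_S‖∞² ≤ CN^{ε/2}`-type; `|n|² ≥ ρ^{-11/10}` on `P_S`).
[cite: BastiCenatiempoSchlein2021, §2 ("`‖γ_S‖∞, ‖σ_S‖∞ ≤ CN^ε`")] -/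
theorem sigma_sq_le_of_mem_softSet {p : ModeBox (boxSize ρ)} (hp : p ∈ softSet ρ) :
    Fock.bogSigma (neg _) (halfSpace _) (tAmp v ρ) p ^ 2 ≤ Real.sqrt (W v ρ 0) / (4 * Real.sqrt 2 * Real.pi) * ρ ^ (-(1 : ℝ) / 20) := by
  have hW0 := W_zero_nonneg v ρ
  have hL := boxSide_pos hρ
  have h := sigma_sq_le_inv_sqrt hv hint hρ (softSet_subset_lowSet hρ hp)
  have hn : ρ ^ (-(11 : ℝ) / 10) ≤ nsq (e _ p) := (mem_softSet.1 hp).1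
  have hn0 : 0 < ρ ^ (-(11 : ℝ) / 10) := Real.rpow_pos_of_pos hρ _
  refine h.trans ?_
  have h2 : (Real.sqrt (nsq (e _ p)))⁻¹ ≤ ρ ^ ((11 : ℝ) / 20) := by
    have hr : ρ ^ ((11 : ℝ) / 20) = (Real.sqrt (ρ ^ (-(11 : ℝ) / 10)))⁻¹ := by
      rw [show (-(11 : ℝ) / 10) = -((11 : ℝ) / 10) by ring, inv_sqrt_rpow_neg hρ]; norm_num
    rw [hr]
    exact inv_anti₀ (Real.sqrt_pos.2 hn0) (Real.sqrt_le_sqrt hn)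
  calc _ ≤ Real.sqrt (ρ * W v ρ 0) * boxSide ρ / (4 * Real.sqrt 2 * Real.pi) * ρ ^ ((11 : ℝ) / 20) :=
        mul_le_mul_of_nonneg_left h2 (by positivity)
    _ = _ := by
        rw [Real.sqrt_mul' _ hW0, ← rpow_combo₅ hρ]
        field_simp

/-- **`sup_{P_H} σ² ≤ (W(0)²/(48π⁴)) ρ^{8/5}`** (`|n|² > ρ^{-2}` on `P_H`; `σ² ≤ (4/3)η²`).
[cite: BastiCenatiempoSchlein2021, §2 ("`|σ_H(p)| ≤ C|η_p|`")] -/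
theorem sigma_sq_le_of_mem_hardSet (hρ1 : ρ ≤ 1) {p : ModeBox (boxSize ρ)} (hp : p ∈ hardSet ρ) :
    Fock.bogSigma (neg _) (halfSpace _) (tAmp v ρ) p ^ 2 ≤ W v ρ 0 ^ 2 / (48 * Real.pi ^ 4) * ρ ^ ((8 : ℝ) / 5) := by
  have hW0 := W_zero_nonneg v ρ
  have hL := boxSide_pos hρ
  have hpz : p ≠ z _ := fun h => z_not_mem_hardSet hρ (h ▸ hp)
  have hpl : p ∉ lowSet ρ := fun h => Finset.disjoint_left.1 (disjoint_hardSet_lowSet hρ hρ1) hp h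
  have h1 := (angles_le_of_not_mem hv hint hρ hpl).1
  have h2 := eta_sq_le_inv_nsq_sq hv hint hρ hpz
  have hn : ρ ^ (-(2 : ℝ)) < nsq (e _ p) := mem_hardSet.1 hp
  have hn0 : 0 < ρ ^ (-(2 : ℝ)) := Real.rpow_pos_of_pos hρ _
  have h3 : (nsq (e _ p) ^ 2)⁻¹ ≤ ρ ^ (4 : ℝ) := by
    have : (ρ ^ (-(2 : ℝ))) ^ 2 ≤ nsq (e _ p) ^ 2 := pow_le_pow_left₀ hn0.le hn.le 2
    calc (nsq (e _ p) ^ 2)⁻¹ ≤ ((ρ ^ (-(2 : ℝ))) ^ 2)⁻¹ := inv_anti₀ (by positivity) this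
      _ = ρ ^ (4 : ℝ) := by
          rw [← Real.rpow_natCast, ← Real.rpow_mul hρ.le, ← Real.rpow_neg hρ.le]; norm_num
  calc _ ≤ 4 / 3 * eta v ρ p ^ 2 := h1
    _ ≤ 4 / 3 * (ρ ^ 2 * W v ρ 0 ^ 2 * boxSide ρ ^ 4 / (64 * Real.pi ^ 4) * (nsq (e _ p) ^ 2)⁻¹) := by gcongr
    _ ≤ 4 / 3 * (ρ ^ 2 * W v ρ 0 ^ 2 * boxSide ρ ^ 4 / (64 * Real.pi ^ 4) * ρ ^ (4 : ℝ)) := by gcongr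
    _ = _ := by
        rw [boxSide_pow_four hρ, show (ρ ^ 2 : ℝ) = ρ ^ (2 : ℝ) by rw [← Real.rpow_natCast]; norm_num]
        have : ρ ^ (2 : ℝ) * ρ ^ (-(22 : ℝ) / 5) * ρ ^ (4 : ℝ) = ρ ^ ((8 : ℝ) / 5) := by
          rw [← Real.rpow_add hρ, ← Real.rpow_add hρ]; norm_num
        field_simp
        rw [← this]
        ring

/-- **`|γ_pσ_p| ≤ (√W(0)/(4√2π)) ρ^{-1/20}` on `P_S`** (`|γσ| = g/(2R)` obeys the bound of `σ²`).
[cite: BastiCenatiempoSchlein2021, §2 ("`‖σ_Lγ_L‖∞`")] -/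
theorem abs_gs_le_of_mem_softSet {p : ModeBox (boxSize ρ)} (hp : p ∈ softSet ρ) :
    |Fock.bogGamma (neg _) (halfSpace _) (tAmp v ρ) p * Fock.bogSigma (neg _) (halfSpace _) (tAmp v ρ) p| ≤
      Real.sqrt (W v ρ 0) / (4 * Real.sqrt 2 * Real.pi) * ρ ^ (-(1 : ℝ) / 20) := by
  have hpl := softSet_subset_lowSet hρ hp
  have hW0 := W_zero_nonneg v ρ
  have hL := boxSide_pos hρ
  have hε := eps_pos' hρ (ne_z_of_mem_lowSet hpl)
  have hg := gCoupling_nonneg hv hint hρ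
  have hgle := gCoupling_le hv hint hρ
  obtain ⟨-, h2, -⟩ := bogSigma_sq_le_of_mem hv hint hρ hpl
  rw [bogGamma_mul_bogSigma_of_mem hv hint hρ hpl, abs_div, abs_neg, abs_of_nonneg hg, abs_of_pos (by positivity)]
  -- same chain as `sigma_sq_le_inv_sqrt`
  have hn : 0 < nsq (e _ p) := (mem_lowSet.1 hpl).1
  have hnl : ρ ^ (-(11 : ℝ) / 10) ≤ nsq (e _ p) := (mem_softSet.1 hp).1
  have hn0 : 0 < ρ ^ (-(11 : ℝ) / 10) := Real.rpow_pos_of_pos hρ _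
  have h3 : gCoupling v ρ / (2 * Real.sqrt (eps ρ p ^ 2 + 2 * gCoupling v ρ * eps ρ p)) ≤
      Real.sqrt (gCoupling v ρ / (8 * eps ρ p)) := Real.le_sqrt_of_sq_le h2
  have h4 : gCoupling v ρ / (8 * eps ρ p) ≤ ρ * W v ρ 0 * boxSide ρ ^ 2 / (32 * Real.pi ^ 2 * nsq (e _ p)) := by
    rw [eps_eq, div_le_div_iff₀ (by positivity) (by positivity)]
    calc gCoupling v ρ * (32 * Real.pi ^ 2 * nsq (e (boxSize ρ) p))
        = gCoupling v ρ * (8 * (4 * Real.pi ^ 2 * nsq (e (boxSize ρ) p) / boxSide ρ ^ 2)) * boxSide ρ ^ 2 := by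
          field_simp; ring
      _ ≤ ρ * W v ρ 0 * boxSide ρ ^ 2 * (8 * (4 * Real.pi ^ 2 * nsq (e (boxSize ρ) p) / boxSide ρ ^ 2)) := by
          nlinarith [mul_le_mul_of_nonneg_right hgle (show 0 ≤ (8 * (4 * Real.pi ^ 2 * nsq (e (boxSize ρ) p) / boxSide ρ ^ 2)) * boxSide ρ ^ 2 by positivity)]
  have h5 : Real.sqrt (ρ * W v ρ 0 * boxSide ρ ^ 2 / (32 * Real.pi ^ 2 * nsq (e _ p))) =
      Real.sqrt (ρ * W v ρ 0) * boxSide ρ / (4 * Real.sqrt 2 * Real.pi) * (Real.sqrt (nsq (e _ p)))⁻¹ := by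
    rw [Real.sqrt_div' _ (by positivity), Real.sqrt_mul' _ (sq_nonneg _), Real.sqrt_sq hL.le,
      Real.sqrt_mul' _ hn.le, show (32 : ℝ) * Real.pi ^ 2 = (4 * Real.sqrt 2 * Real.pi) ^ 2 by
        rw [mul_pow, mul_pow, Real.sq_sqrt (by norm_num : (0:ℝ) ≤ 2)]; ring, Real.sqrt_sq (by positivity)]
    field_simp
  have h6 : (Real.sqrt (nsq (e _ p)))⁻¹ ≤ ρ ^ ((11 : ℝ) / 20) := by
    have hr : ρ ^ ((11 : ℝ) / 20) = (Real.sqrt (ρ ^ (-(11 : ℝ) / 10)))⁻¹ := by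
      rw [show (-(11 : ℝ) / 10) = -((11 : ℝ) / 10) by ring, inv_sqrt_rpow_neg hρ]; norm_num
    rw [hr]
    exact inv_anti₀ (Real.sqrt_pos.2 hn0) (Real.sqrt_le_sqrt hnl)
  calc _ ≤ Real.sqrt (gCoupling v ρ / (8 * eps ρ p)) := h3
    _ ≤ Real.sqrt (ρ * W v ρ 0 * boxSide ρ ^ 2 / (32 * Real.pi ^ 2 * nsq (e _ p))) := Real.sqrt_le_sqrt h4
    _ = _ := h5
    _ ≤ Real.sqrt (ρ * W v ρ 0) * boxSide ρ / (4 * Real.sqrt 2 * Real.pi) * ρ ^ ((11 : ℝ) / 20) :=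
        mul_le_mul_of_nonneg_left h6 (by positivity)
    _ = _ := by
        rw [Real.sqrt_mul' _ hW0, ← rpow_combo₅ hρ]
        field_simp

/-- **`|γ_pσ_p| ≤ (W(0)/(6π²)) ρ^{4/5}` on `P_H`** (`|γσ| ≤ (4/3)|η|`). [cite: BastiCenatiempoSchlein2021, §2] -/
theorem abs_gs_le_of_mem_hardSet (hρ1 : ρ ≤ 1) {p : ModeBox (boxSize ρ)} (hp : p ∈ hardSet ρ) :
    |Fock.bogGamma (neg _) (halfSpace _) (tAmp v ρ) p * Fock.bogSigma (neg _) (halfSpace _) (tAmp v ρ) p| ≤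
      W v ρ 0 / (6 * Real.pi ^ 2) * ρ ^ ((4 : ℝ) / 5) := by
  have hW0 := W_zero_nonneg v ρ
  have hL := boxSide_pos hρ
  have hpz : p ≠ z _ := fun h => z_not_mem_hardSet hρ (h ▸ hp)
  have hpl : p ∉ lowSet ρ := fun h => Finset.disjoint_left.1 (disjoint_hardSet_lowSet hρ hρ1) hp h
  have h1 := (angles_le_of_not_mem hv hint hρ hpl).2.1
  have h2 := abs_eta_le hv hint hρ hpz
  have hn : ρ ^ (-(2 : ℝ)) < nsq (e _ p) := mem_hardSet.1 hp
  have hn0 : 0 < ρ ^ (-(2 : ℝ)) := Real.rpow_pos_of_pos hρ _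
  have h3 : ρ * W v ρ 0 * boxSide ρ ^ 2 / (8 * Real.pi ^ 2 * nsq (e _ p)) ≤ ρ * W v ρ 0 * boxSide ρ ^ 2 / (8 * Real.pi ^ 2 * ρ ^ (-(2 : ℝ))) :=
    div_le_div_of_nonneg_left (by positivity) (by positivity) (by nlinarith [Real.pi_pos])
  calc _ ≤ 4 / 3 * |eta v ρ p| := h1
    _ ≤ 4 / 3 * (ρ * W v ρ 0 * boxSide ρ ^ 2 / (8 * Real.pi ^ 2 * ρ ^ (-(2 : ℝ)))) := by gcongr; exact h2.trans h3
    _ = _ := by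
        rw [boxSide_sq hρ]
        have : ρ * ρ ^ (-(11 : ℝ) / 5) / ρ ^ (-(2 : ℝ)) = ρ ^ ((4 : ℝ) / 5) := by
          rw [div_eq_iff (Real.rpow_pos_of_pos hρ _).ne', ← Real.rpow_add hρ,
            show (ρ : ℝ) * ρ ^ (-(11 : ℝ) / 5) = ρ ^ (1 : ℝ) * ρ ^ (-(11 : ℝ) / 5) by rw [Real.rpow_one], ← Real.rpow_add hρ]
          norm_num
        field_simp
        rw [← this]
        field_simp
        ring

/-- **`γ_p² = 1 + σ_p²`.** [cite: BastiCenatiempoSchlein2021, (2.11)] -/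
theorem gamma_sq_eq (p : ModeBox (boxSize ρ)) :
    Fock.bogGamma (neg _) (halfSpace _) (tAmp v ρ) p ^ 2 = 1 + Fock.bogSigma (neg _) (halfSpace _) (tAmp v ρ) p ^ 2 := by
  have h := Fock.bogGamma_sq_sub_bogSigma_sq (σ := neg _) (P := halfSpace _) (t := tAmp v ρ) (abs_tAmp_lt_one' hv hint hρ) p
  linarith

omit hv hint in
/-- **`|P_S| ≤ 24(ρ^{-7/10} + 1)³`.** [folklore] -/
theorem card_softSet_le : ((softSet ρ).card : ℝ) ≤ 24 * (ρ ^ (-(7 : ℝ) / 10) + 1) ^ 3 := by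
  have h := card_nsq_le (softSet ρ) (A := ρ ^ (-(7 : ℝ) / 5)) fun p hp => (mem_softSet.1 hp).2
  have hs : Real.sqrt (ρ ^ (-(7 : ℝ) / 5)) = ρ ^ (-(7 : ℝ) / 10) := by
    rw [Real.sqrt_eq_rpow, ← Real.rpow_mul hρ.le]; norm_num
  rwa [hs] at h

omit hv hint in
/-- `|P_S| ≤ 192 ρ^{-21/10}` for `ρ ≤ 1`. [folklore] -/
theorem card_softSet_le' (hρ1 : ρ ≤ 1) : ((softSet ρ).card : ℝ) ≤ 192 * ρ ^ (-(21 : ℝ) / 10) := by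
  refine (card_softSet_le hρ).trans ?_
  have h1 : (1 : ℝ) ≤ ρ ^ (-(7 : ℝ) / 10) := Real.one_le_rpow_of_pos_of_le_one_of_nonpos hρ hρ1 (by norm_num)
  have h2 : (ρ ^ (-(7 : ℝ) / 10) + 1) ^ 3 ≤ (2 * ρ ^ (-(7 : ℝ) / 10)) ^ 3 :=
    pow_le_pow_left₀ (by positivity) (by linarith) 3
  have h3 : (ρ ^ (-(7 : ℝ) / 10)) ^ 3 = ρ ^ (-(21 : ℝ) / 10) := by
    rw [← Real.rpow_natCast, ← Real.rpow_mul hρ.le]; norm_num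
  calc 24 * (ρ ^ (-(7 : ℝ) / 10) + 1) ^ 3 ≤ 24 * (2 * ρ ^ (-(7 : ℝ) / 10)) ^ 3 := by gcongr
    _ = 192 * ρ ^ (-(21 : ℝ) / 10) := by rw [mul_pow, h3]; ring

end EtaNorm

end BCSTrial

end Literature.MathematicalPhysics.QuantumManyBody.BoseGas

end
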